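import Summits.ResolutionOfSingularities.ResolutionOfSingularities.Theorems.PurelyInseparableDim4PureLeafUnitTrap
import Summits.ResolutionOfSingularities.ResolutionOfSingularities.Theorems.PurelyInseparableDim4EscapableInvariance
import HarnessLib
import HarnessLib.Audit.Tags

/-!
# Purely inseparable fourfolds — the unit-leaf trap family under the `S₄`-action and arbitrary bookings:
# every relabelled, re-booked `F m` is a point of no return for MODE 1h over `𝔽₂`

Census cell «res-dim4-pi» (D-0157 DOOR 2), width seat `res-dim4-p-10` (generation 3), brick (i) of desk WORD #132 (c),
fourth file (bookkeeping for the tie-break census of unit leaves, kit job j324883).  The trap family of p693684,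
`F m = x₁ · (x₃ + ⋯ + x₃^{m+1} + x₀ + x₀²x₃^m + x₀²x₃^{m+1})` over `𝔽₂`, was stated in ONE labelling of the variables and,
for the MODE-1h edge `F m → F (m+1)`, with multiplicity book `r = 0`.  A census branch may reach the family in another
labelling and with any books; this file supplies the two missing invariances, both def-free:

* `step_F_F`, `step1h_F_any` — the family edge `⟨F m, r, exc⟩ → ⟨F (m+1), ·, ·⟩` is a MODE-1h step for EVERY booking
  `(r, exc)` (the rule reads `F` only; the books are carried along);
* `not_stateWins_F_rename` — every `S₄`-relabelling of every booking of every `F m` is LOST for player A in the plain game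
  (p-14's `EscapableInvariance.stateWins_rename_iff` on top of `not_stateWins_F`);
* `exists_chain_F_rename` — **from every such state there is an infinite MODE-1h chain none of whose states is won**:
  reaching the `S₄`-orbit of the family, in any booking, is a point of no return (token TRAP-K of the census).

[OURS · counted 0]  Nothing in this file proves or refutes resolution of singularities in dimension ≥ 4 / characteristic p,
and nothing here is stronger than expert review.  TIER-2 statements about the PLAIN game / MODE 1h with `𝔽₂`-rational
replies, not about CJS. bears_on: LADDER-RESOLUTION:D157-DOOR2 (res-dim4-pi · brick (i) · orbit bookkeeping). Supports
stmt-ResolutionOfSingularities-16155 (helper).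
-/

set_option linter.dupNamespace false

open MvPolynomial Finset

namespace Summit.ResolutionOfSingularities.ResolutionOfSingularities.Theorems.PIDim4

namespace UnitDivergence

open Literature.AlgebraicGeometry.Resolution
open Literature.AlgebraicGeometry.Resolution.Hauser2010
open CentreBlowup StepKit PthPowerFactor

/-! ## 1. The family edge with arbitrary books -/

/-- The `F`-component of the family step does not see the books: `(step ⟨F m, r, exc⟩).F = F (m+1)`. [folklore] -/
theorem step_F_F (m : ℕ) (r : Fin 4 →₀ ℕ) (exc : Finset (Fin 4)) :
    (step 2 ({0, 1, 3} : Finset (Fin 4)) 3 (fun i => if i = 0 then 1 else 0)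
      (⟨X 1 * ((∑ t ∈ Finset.range (m + 1), X 3 ^ (t + 1)) + X 0 + X 0 ^ 2 * X 3 ^ m + X 0 ^ 2 * X 3 ^ (m + 1)), r, exc⟩ :
        State (ZMod 2))).F =
      X 1 * ((∑ t ∈ Finset.range (m + 2), X 3 ^ (t + 1)) + X 0 + X 0 ^ 2 * X 3 ^ (m + 1) + X 0 ^ 2 * X 3 ^ (m + 2)) := by
  show deletePthPowers 2 (pointTransform 2 ({0, 1, 3} : Finset (Fin 4)) 3 (fun i => if i = 0 then 1 else 0) _) = _
  rw [pointTransform_F, deletePthPowers_F (m + 1)]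

/-- The same for a state known only through its `F`-component. [folklore] -/
theorem step_F_of_F_eq (m : ℕ) (s : State (ZMod 2))
    (hs : s.F = X 1 * ((∑ t ∈ Finset.range (m + 1), X 3 ^ (t + 1)) + X 0 + X 0 ^ 2 * X 3 ^ m + X 0 ^ 2 * X 3 ^ (m + 1))) :
    (step 2 ({0, 1, 3} : Finset (Fin 4)) 3 (fun i => if i = 0 then 1 else 0) s).F =
      X 1 * ((∑ t ∈ Finset.range (m + 2), X 3 ^ (t + 1)) + X 0 + X 0 ^ 2 * X 3 ^ (m + 1) + X 0 ^ 2 * X 3 ^ (m + 2)) := by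
  obtain ⟨F, r, exc⟩ := s
  simp only at hs
  subst hs
  exact step_F_F m r exc

/-- **`⟨F m, r, exc⟩ → step` is a MODE-1h step for EVERY booking.** [OURS · counted 0] [folklore] -/
theorem step1h_F_any (m : ℕ) (r : Fin 4 →₀ ℕ) (exc : Finset (Fin 4)) :
    Step1h 2 (⟨X 1 * ((∑ t ∈ Finset.range (m + 1), X 3 ^ (t + 1)) + X 0 + X 0 ^ 2 * X 3 ^ m + X 0 ^ 2 * X 3 ^ (m + 1)), r, exc⟩ :
        State (ZMod 2))
      (step 2 ({0, 1, 3} : Finset (Fin 4)) 3 (fun i => if i = 0 then 1 else 0)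
        (⟨X 1 * ((∑ t ∈ Finset.range (m + 1), X 3 ^ (t + 1)) + X 0 + X 0 ^ 2 * X 3 ^ m + X 0 ^ 2 * X 3 ^ (m + 1)), r, exc⟩ :
          State (ZMod 2))) := by
  refine ⟨{0, 1, 3}, isMode1hCentre_F m, 3, (fun i => if i = 0 then 1 else 0), by decide, rfl, ?_, ?_, rfl⟩
  · -- equimultiple: the transform `F (m+1)` has no monomial of degree `< 2`
    intro d hd0 hdeg
    rw [pointTransform_F]
    obtain ⟨i, rfl⟩ := PthPowerFactor.eq_single_of_degree_lt_two hd0 hdeg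
    by_contra hne
    have h2 := (support_F_props (m + 1) (MvPolynomial.mem_support_iff.mpr hne)).2.2
    rw [Finsupp.degree_single] at h2
    omega
  · rw [step_F_F]
    exact F_ne_zero (m + 1)

/-- The same for a state known only through its `F`-component. [folklore] -/
theorem step1h_of_F_eq (m : ℕ) (s : State (ZMod 2))
    (hs : s.F = X 1 * ((∑ t ∈ Finset.range (m + 1), X 3 ^ (t + 1)) + X 0 + X 0 ^ 2 * X 3 ^ m + X 0 ^ 2 * X 3 ^ (m + 1))) :
    Step1h 2 s (step 2 ({0, 1, 3} : Finset (Fin 4)) 3 (fun i => if i = 0 then 1 else 0) s) := by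
  obtain ⟨F, r, exc⟩ := s
  simp only at hs
  subst hs
  exact step1h_F_any m r exc

/-- A state whose `F`-component is some `F m` is LOST for player A (plain game, every booking). [folklore] -/
theorem not_stateWins_of_F_eq (m : ℕ) (s : State (ZMod 2))
    (hs : s.F = X 1 * ((∑ t ∈ Finset.range (m + 1), X 3 ^ (t + 1)) + X 0 + X 0 ^ 2 * X 3 ^ m + X 0 ^ 2 * X 3 ^ (m + 1))) :
    ¬ StateWins 2 s := by
  obtain ⟨F, r, exc⟩ := s
  simp only at hs
  subst hs
  exact not_stateWins_F m r exc

/-! ## 2. The `S₄`-orbit -/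

/-- **Every relabelling of every booking of every `F m` is LOST for A** (plain game over `𝔽₂`). [OURS · counted 0] [folklore] -/
theorem not_stateWins_F_rename (e : Equiv.Perm (Fin 4)) (m : ℕ) (r : Fin 4 →₀ ℕ) (exc : Finset (Fin 4)) :
    ¬ StateWins 2 (State.rename e (⟨X 1 * ((∑ t ∈ Finset.range (m + 1), X 3 ^ (t + 1)) + X 0 + X 0 ^ 2 * X 3 ^ m + X 0 ^ 2 * X 3 ^ (m + 1)),
      r, exc⟩ : State (ZMod 2))) := fun h =>
  not_stateWins_F m r exc ((EscapableInvariance.stateWins_rename_iff 2 e _).mp h)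

/-- **Point of no return.** From every `S₄`-relabelling of every booking of every `F m` there is an INFINITE MODE-1h chain
none of whose states is won by A in the plain game: the relabelled family chain. [OURS · counted 0] [folklore] -/
theorem exists_chain_F_rename (e : Equiv.Perm (Fin 4)) (m : ℕ) (r : Fin 4 →₀ ℕ) (exc : Finset (Fin 4)) :
    ∃ c : ℕ → State (ZMod 2),
      c 0 = State.rename e (⟨X 1 * ((∑ t ∈ Finset.range (m + 1), X 3 ^ (t + 1)) + X 0 + X 0 ^ 2 * X 3 ^ m + X 0 ^ 2 * X 3 ^ (m + 1)),
        r, exc⟩ : State (ZMod 2)) ∧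
        (∀ k, Step1h 2 (c k) (c (k + 1))) ∧ ∀ k, ¬ StateWins 2 (c k) := by
  -- the un-relabelled chain: iterate the family step from `⟨F m, r, exc⟩`
  let tail : ℕ → State (ZMod 2) := fun k => Nat.rec
    (⟨X 1 * ((∑ t ∈ Finset.range (m + 1), X 3 ^ (t + 1)) + X 0 + X 0 ^ 2 * X 3 ^ m + X 0 ^ 2 * X 3 ^ (m + 1)), r, exc⟩ :
      State (ZMod 2))
    (fun _ s => step 2 ({0, 1, 3} : Finset (Fin 4)) 3 (fun i => if i = 0 then 1 else 0) s) k
  have hF : ∀ k, (tail k).F =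
      X 1 * ((∑ t ∈ Finset.range (m + k + 1), X 3 ^ (t + 1)) + X 0 + X 0 ^ 2 * X 3 ^ (m + k) + X 0 ^ 2 * X 3 ^ (m + k + 1)) := by
    intro k
    induction k with
    | zero => rfl
    | succ k ih =>
      show (step 2 ({0, 1, 3} : Finset (Fin 4)) 3 (fun i => if i = 0 then 1 else 0) (tail k)).F = _
      rw [step_F_of_F_eq (m + k) (tail k) ih]
      rfl
  refine ⟨fun k => State.rename e (tail k), rfl, fun k => ?_, fun k => ?_⟩
  · exact Equivariance.step1h_rename e (step1h_of_F_eq (m + k) (tail k) (hF k))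
  · rw [EscapableInvariance.stateWins_rename_iff]
    exact not_stateWins_of_F_eq (m + k) (tail k) (hF k)

end UnitDivergence

end Summit.ResolutionOfSingularities.ResolutionOfSingularities.Theorems.PIDim4
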